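import Literature.NumberTheory.Automorphic.MirabolicEisensteinConvergence
import Literature.NumberTheory.Automorphic.AdelicHeightGLProofs
import HarnessLib

/-!
# Theta sums of decaying functions on `𝔸_Kᴺ` grow at most polynomially in the archimedean height

Topic `NumberTheory/Automorphic`; namespace `Literature.NumberTheory.Automorphic`. Proof file
(theorems only). The "slow growth of theta series" half of the absolute convergence of the
Godement–Jacquet integrals against cusp forms (Godement–Jacquet, LNM 260 (1972), §11,
Lemma 11.5–11.6, and §12; Jacquet, *Principal L-functions of the linear group* (1979), §1: the
theta series `Σ_ξ Φ(h ξ g)` is "slowly increasing"), in the elementary form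

  `Σ_{ξ ∈ Kᴺ} |Ψ(ξ L)| ≤ B · (1 ⊔ N² H_∞(L))^θ`   (`L ∈ GL_N(𝔸_K)`, `L_f` in a fixed compact set),

for every `Ψ : 𝔸_Kᴺ → ℂ` with `|Ψ(x)| ≤ M (1 + ‖x_∞‖)^{-k}` vanishing unless `x_f` lies in a compact
set (`θ ∈ (N [K:ℚ], k]`; `H_∞ = GLn.archHeight`, the archimedean local height of `AdelicGLnGlue`):

* `norm_vecInfinitePart_ratVec_le_mul` — `‖ξ_∞‖ ≤ G(L) ‖(ξ L)_∞‖`, `G(L) = Σ_{k,l} ‖(L⁻¹)_{∞,kl}‖`;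
  `sum_norm_inv_arch_le_mul_archHeight` — `G(L) ≤ N² H_∞(L)`;
* `tsum_enorm_vecMul_le_of_decay` — **pointwise in `L`**:
  `Σ_ξ |Ψ(ξ L)| ≤ M + M G^θ Σ_{ξ ≠ 0, ξ_f ∈ C'} ‖ξ_∞‖^{-θ}` whenever `(ξ L)_f ∈ C_f ⇒ ξ_f ∈ C'`
  (the term `ξ = 0`, and `(1 + t/G)^{-k} ≤ G^θ t^{-θ}` for `ξ ≠ 0`);
* `exists_isCompact_vecFinitePart_mem` — if `L_f ∈ 𝒴` (compact) one may take `C' = C_f 𝒴⁻¹`;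
* `exists_tsum_enorm_vecMul_le_archHeight_rpow` — **the polynomial bound**, with
  `B = M + M Z_θ(C')`, `Z_θ(C') = Σ_{ξ ≠ 0, ξ_f ∈ C'} ‖ξ_∞‖^{-θ} < ∞`
  (`tsum_norm_vecInfinitePart_rpow_neg_lt_top` of `AdelicRationalVectorCount`).

No Siegel sets and no reduction theory enter: the dependence on `L` is through `L_∞⁻¹` only, the
finite part being confined to a compact set (in the application, `L = x₀ ⊗ (a y⁻¹)ᵀ` with `y_f` in
a compact set of representatives).

## References

* R. Godement, H. Jacquet, *Zeta functions of simple algebras*, LNM 260 (1972), §11–12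
  [GodementJacquetLNM260].
* A. Borel, *Introduction aux groupes arithmétiques* (1969), §8 [Borel1969].
-/

noncomputable section

open scoped NNReal ENNReal Pointwise Classical RestrictedProduct
open NumberField NumberField.mixedEmbedding IsDedekindDomain Set MeasureTheory Measure Matrix Module

namespace Literature.NumberTheory.Automorphic

variable (K : Type) [Field K] [NumberField K] {N : ℕ}

/-- The archimedean coordinates of a principal vector are bounded by those of `ξ L` times the size
`G(L) = ∑_{k,l} ‖(L⁻¹)_{∞,kl}‖` of `L_∞⁻¹`: `‖ξ_∞‖ ≤ G(L) ‖(ξ L)_∞‖`. [folklore] -/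
theorem norm_vecInfinitePart_ratVec_le_mul (v : Fin N → K) (L : GL (Fin N) (AdeleRing (𝓞 K) K)) :
    ‖vecInfinitePart K N (ratVec K v)‖ ≤
      (∑ k, ∑ l, ‖(((L⁻¹ : GL (Fin N) (AdeleRing (𝓞 K) K)) :
          Matrix (Fin N) (Fin N) (AdeleRing (𝓞 K) K)).map
            fun a => InfiniteAdeleRing.ringEquiv_mixedSpace K a.1) k l‖) *
        ‖vecInfinitePart K N (ratVec K v ᵥ* (L : Matrix (Fin N) (Fin N) (AdeleRing (𝓞 K) K)))‖ := by
  rw [vecInfinitePart_ratVec]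
  refine (pi_norm_le_iff_of_nonneg (by positivity)).2 fun i => ?_
  exact norm_mixedEmbedding_le_mul_norm_vecInfinitePart K v L i

/-- **The theta sum of a decaying function, pointwise in `L`.** Let `Ψ : 𝔸_Kᴺ → ℂ` satisfy
`|Ψ(x)| ≤ M (1 + ‖x_∞‖)^{-k}` and vanish unless `x_f ∈ C_f`; let `L ∈ GL_N(𝔸_K)` be such that
`(ξ L)_f ∈ C_f` forces `ξ_f ∈ C'` (`ξ ∈ Kᴺ`), and let `G ≥ ∑_{k,l} ‖(L⁻¹)_{∞,kl}‖`, `G > 0`. Then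
for `0 ≤ θ ≤ k`,
`∑_{ξ ∈ Kᴺ} |Ψ(ξ L)| ≤ M + M G^θ · ∑_{ξ ≠ 0, ξ_f ∈ C'} ‖ξ_∞‖^{-θ}`:
the term `ξ = 0` is at most `M`; for `ξ ≠ 0`, `‖(ξ L)_∞‖ ≥ G⁻¹ ‖ξ_∞‖` and
`(1 + G⁻¹ t)^{-k} ≤ G^θ t^{-θ}`. (The lattice sum on the right is finite for `θ > N [K:ℚ]` and
compact `C'`, `tsum_norm_vecInfinitePart_rpow_neg_lt_top`.) Godement–Jacquet (1972), proof of
Lemma 11.5–11.6, in the form needed for the singular theta series of §12. [cite: GodementJacquetLNM260, §11] -/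
theorem tsum_enorm_vecMul_le_of_decay {Ψ : (Fin N → AdeleRing (𝓞 K) K) → ℂ} {k : ℕ} {M : ℝ}
    (hM0 : 0 ≤ M) (hM : ∀ x, ‖Ψ x‖ ≤ M * (1 + ‖vecInfinitePart K N x‖) ^ (-(k : ℝ)))
    {Cf : Set (Fin N → FiniteAdeleRing (𝓞 K) K)} (hCf : ∀ x, vecFinitePart K N x ∉ Cf → Ψ x = 0)
    {C' : Set (Fin N → FiniteAdeleRing (𝓞 K) K)} (L : GL (Fin N) (AdeleRing (𝓞 K) K))
    (hL : ∀ v : Fin N → K,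
      vecFinitePart K N (ratVec K v ᵥ* (L : Matrix (Fin N) (Fin N) (AdeleRing (𝓞 K) K))) ∈ Cf →
        vecFinitePart K N (ratVec K v) ∈ C')
    {G : ℝ} (hG0 : 0 < G)
    (hGL : (∑ k, ∑ l, ‖(((L⁻¹ : GL (Fin N) (AdeleRing (𝓞 K) K)) :
          Matrix (Fin N) (Fin N) (AdeleRing (𝓞 K) K)).map
            fun a => InfiniteAdeleRing.ringEquiv_mixedSpace K a.1) k l‖) ≤ G)
    {θ : ℝ} (hθ0 : 0 ≤ θ) (hθk : θ ≤ k) :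
    ∑' v : Fin N → K, (‖Ψ (ratVec K v ᵥ* (L : Matrix (Fin N) (Fin N) (AdeleRing (𝓞 K) K)))‖ₑ : ℝ≥0∞) ≤
      ENNReal.ofReal M + ENNReal.ofReal (M * G⁻¹ ^ (-θ)) *
        ∑' v : ↥{v : Fin N → K | v ≠ 0 ∧ vecFinitePart K N (ratVec K v) ∈ C'},
          ENNReal.ofReal (‖vecInfinitePart K N (ratVec K (v : Fin N → K))‖ ^ (-θ)) := by
  set Λ : Set (Fin N → K) := {v : Fin N → K | v ≠ 0 ∧ vecFinitePart K N (ratVec K v) ∈ C'} with hΛ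
  set A : ℝ≥0∞ := ENNReal.ofReal (M * G⁻¹ ^ (-θ)) with hA
  set F : (Fin N → K) → ℝ≥0∞ := fun v =>
    A * ENNReal.ofReal (‖vecInfinitePart K N (ratVec K v)‖ ^ (-θ)) with hF
  -- pointwise bound for `v ≠ 0`
  have hpt : ∀ v : Fin N → K, v ≠ 0 →
      (‖Ψ (ratVec K v ᵥ* (L : Matrix (Fin N) (Fin N) (AdeleRing (𝓞 K) K)))‖ₑ : ℝ≥0∞) ≤
        Λ.indicator F v := by
    intro v hv
    by_cases hC : vecFinitePart K N (ratVec K v ᵥ* (L : Matrix (Fin N) (Fin N) (AdeleRing (𝓞 K) K))) ∈ Cf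
    · have hvΛ : v ∈ Λ := ⟨hv, hL v hC⟩
      rw [indicator_of_mem hvΛ]
      have hNpos : 0 < ‖vecInfinitePart K N (ratVec K v)‖ := by
        have h := norm_vecInfinitePart_ratVec_vecMul_pos K hv (1 : GL (Fin N) (AdeleRing (𝓞 K) K))
        rwa [Matrix.GeneralLinearGroup.coe_one, Matrix.vecMul_one] at h
      have hlow : G⁻¹ * ‖vecInfinitePart K N (ratVec K v)‖ ≤
          ‖vecInfinitePart K N (ratVec K v ᵥ* (L : Matrix (Fin N) (Fin N) (AdeleRing (𝓞 K) K)))‖ := by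
        rw [inv_mul_le_iff₀ hG0]
        exact (norm_vecInfinitePart_ratVec_le_mul K v L).trans
          (mul_le_mul_of_nonneg_right hGL (norm_nonneg _))
      exact enorm_le_ofReal_mul_ofReal hM0 (inv_pos.2 hG0)
        (le_mul_rpow_neg_mul_rpow_neg hM0 (hM _) (inv_pos.2 hG0) hNpos hlow hθ0 hθk)
    · rw [hCf _ hC, enorm_zero]
      exact zero_le
  -- the term `v = 0`
  have h0 : (‖Ψ (ratVec K (0 : Fin N → K) ᵥ* (L : Matrix (Fin N) (Fin N) (AdeleRing (𝓞 K) K)))‖ₑ : ℝ≥0∞) ≤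
      ENNReal.ofReal M := by
    have hz : ratVec K (0 : Fin N → K) = 0 := by
      funext i
      simp [ratVec]
    rw [hz, Matrix.zero_vecMul, ← ofReal_norm]
    refine ENNReal.ofReal_le_ofReal ((hM 0).trans ?_)
    have h1 : (1 + ‖vecInfinitePart K N (0 : Fin N → AdeleRing (𝓞 K) K)‖) ^ (-(k : ℝ)) ≤ 1 := by
      refine Real.rpow_le_one_of_one_le_of_nonpos ?_ (neg_nonpos.2 (Nat.cast_nonneg k))
      linarith [norm_nonneg (vecInfinitePart K N (0 : Fin N → AdeleRing (𝓞 K) K))]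
    calc M * (1 + ‖vecInfinitePart K N (0 : Fin N → AdeleRing (𝓞 K) K)‖) ^ (-(k : ℝ)) ≤ M * 1 :=
          mul_le_mul_of_nonneg_left h1 hM0
      _ = M := mul_one M
  -- summation
  set g0 : (Fin N → K) → ℝ≥0∞ := ({0} : Set (Fin N → K)).indicator fun _ => ENNReal.ofReal M with hg0
  have hpt' : ∀ v : Fin N → K,
      (‖Ψ (ratVec K v ᵥ* (L : Matrix (Fin N) (Fin N) (AdeleRing (𝓞 K) K)))‖ₑ : ℝ≥0∞) ≤
        g0 v + Λ.indicator F v := by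
    intro v
    by_cases hv : v = 0
    · subst hv
      have : g0 0 = ENNReal.ofReal M := by rw [hg0, indicator_of_mem (mem_singleton _)]
      rw [this]
      exact h0.trans le_self_add
    · exact (hpt v hv).trans le_add_self
  have h1 : ∑' v : Fin N → K, g0 v = ENNReal.ofReal M := by
    rw [hg0, tsum_eq_single (0 : Fin N → K)]
    · rw [indicator_of_mem (mem_singleton _)]
    · intro v hv
      exact indicator_of_notMem (fun h => hv (mem_singleton_iff.1 h)) _
  have h2 : ∑' v : Fin N → K, Λ.indicator F v =
      A * ∑' v : Λ, ENNReal.ofReal (‖vecInfinitePart K N (ratVec K (v : Fin N → K))‖ ^ (-θ)) := by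
    rw [← tsum_subtype Λ F]
    simp only [hF]
    exact ENNReal.tsum_mul_left
  calc ∑' v : Fin N → K, (‖Ψ (ratVec K v ᵥ* (L : Matrix (Fin N) (Fin N) (AdeleRing (𝓞 K) K)))‖ₑ : ℝ≥0∞)
      ≤ ∑' v : Fin N → K, (g0 v + Λ.indicator F v) := ENNReal.tsum_le_tsum hpt'
    _ = ∑' v : Fin N → K, g0 v + ∑' v : Fin N → K, Λ.indicator F v := ENNReal.tsum_add
    _ = _ := by rw [h1, h2]

/-! ### Bookkeeping: the size of `L_∞⁻¹` against the archimedean height, and the finite parts -/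

/-- The size `G(L) = ∑_{k,l} ‖(L⁻¹)_{∞,kl}‖` of `L_∞⁻¹` is at most `N² H_∞(L)`. [folklore] -/
theorem sum_norm_inv_arch_le_mul_archHeight (L : GL (Fin N) (AdeleRing (𝓞 K) K)) :
    (∑ k, ∑ l, ‖(((L⁻¹ : GL (Fin N) (AdeleRing (𝓞 K) K)) :
        Matrix (Fin N) (Fin N) (AdeleRing (𝓞 K) K)).map
          fun a => InfiniteAdeleRing.ringEquiv_mixedSpace K a.1) k l‖) ≤
      (N : ℝ) ^ 2 * (GLn.archHeight N K L : ℝ) := by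
  set Linv : Matrix (Fin N) (Fin N) (mixedSpace K) :=
    ((L⁻¹ : GL (Fin N) (AdeleRing (𝓞 K) K)) : Matrix (Fin N) (Fin N) (AdeleRing (𝓞 K) K)).map
      fun a => InfiniteAdeleRing.ringEquiv_mixedSpace K a.1 with hLinv
  have hkl : ∀ k l : Fin N, ‖Linv k l‖ ≤ (GLn.archHeight N K L : ℝ) := by
    intro k l
    have h := nnnorm_inv_apply_le_sup (GLn.toMixed N K L) k l
    rw [← map_inv] at h
    have h' : ‖Linv k l‖₊ ≤ GLn.archHeight N K L := h
    exact_mod_cast h'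
  calc (∑ k, ∑ l, ‖Linv k l‖)
      ≤ ∑ _k : Fin N, ∑ _l : Fin N, (GLn.archHeight N K L : ℝ) :=
        Finset.sum_le_sum fun k _ => Finset.sum_le_sum fun l _ => hkl k l
    _ = (N : ℝ) ^ 2 * (GLn.archHeight N K L : ℝ) := by
        rw [Finset.sum_const, Finset.sum_const, Finset.card_univ, Fintype.card_fin, nsmul_eq_mul,
          nsmul_eq_mul]
        ring

/-- The finite part of `ξ L` is `ξ_f L_f`. [folklore] -/
theorem vecFinitePart_vecMul_eq_sndHom (x : Fin N → AdeleRing (𝓞 K) K) (L : GL (Fin N) (AdeleRing (𝓞 K) K)) :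
    vecFinitePart K N (x ᵥ* (L : Matrix (Fin N) (Fin N) (AdeleRing (𝓞 K) K))) =
      vecFinitePart K N x ᵥ* ((GLn.sndHom N K L : GL (Fin N) (FiniteAdeleRing (𝓞 K) K)) :
        Matrix (Fin N) (Fin N) (FiniteAdeleRing (𝓞 K) K)) := by
  rw [vecFinitePart_vecMul]
  rfl

/-- **If `L_f` lies in a compact set `𝒴`, then `(ξ L)_f ∈ C_f` forces `ξ_f` into the compact set
`C_f · 𝒴⁻¹`.** [folklore] -/
theorem exists_isCompact_vecFinitePart_mem {Cf : Set (Fin N → FiniteAdeleRing (𝓞 K) K)} (hCf : IsCompact Cf)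
    {𝒴 : Set (GL (Fin N) (FiniteAdeleRing (𝓞 K) K))} (h𝒴 : IsCompact 𝒴) :
    ∃ C' : Set (Fin N → FiniteAdeleRing (𝓞 K) K), IsCompact C' ∧
      ∀ L : GL (Fin N) (AdeleRing (𝓞 K) K), GLn.sndHom N K L ∈ 𝒴 → ∀ v : Fin N → K,
        vecFinitePart K N (ratVec K v ᵥ* (L : Matrix (Fin N) (Fin N) (AdeleRing (𝓞 K) K))) ∈ Cf →
          vecFinitePart K N (ratVec K v) ∈ C' := by
  set F : (Fin N → FiniteAdeleRing (𝓞 K) K) × GL (Fin N) (FiniteAdeleRing (𝓞 K) K) →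
      (Fin N → FiniteAdeleRing (𝓞 K) K) := fun p =>
    p.1 ᵥ* ((p.2⁻¹ : GL (Fin N) (FiniteAdeleRing (𝓞 K) K)) : Matrix (Fin N) (Fin N) (FiniteAdeleRing (𝓞 K) K))
    with hF
  have hFc : Continuous F :=
    continuous_fst.matrix_vecMul (Units.continuous_val.comp (continuous_inv.comp continuous_snd))
  refine ⟨F '' (Cf ×ˢ 𝒴), (hCf.prod h𝒴).image hFc, fun L hL v hv => ?_⟩
  refine ⟨(vecFinitePart K N (ratVec K v ᵥ* (L : Matrix (Fin N) (Fin N) (AdeleRing (𝓞 K) K))),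
    GLn.sndHom N K L), ⟨hv, hL⟩, ?_⟩
  simp only [hF]
  rw [vecFinitePart_vecMul_eq_sndHom, Matrix.vecMul_vecMul, ← Matrix.GeneralLinearGroup.coe_mul,
    mul_inv_cancel, Matrix.GeneralLinearGroup.coe_one, Matrix.vecMul_one]

/-- **Theta sums grow at most polynomially in the archimedean height** (uniformly for finite
parts in a compact set): for `Ψ` with `|Ψ(x)| ≤ M (1 + ‖x_∞‖)^{-k}` vanishing unless `x_f ∈ C_f`
(`C_f` compact), a compact `𝒴 ⊆ GL_N(𝔸_K^∞)` and `N [K:ℚ] < θ ≤ k`, there is `B < ∞` with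
`∑_{ξ ∈ Kᴺ} |Ψ(ξ L)| ≤ B · (1 ⊔ N² H_∞(L))^θ` for every `L ∈ GL_N(𝔸_K)` with `L_f ∈ 𝒴`.
Godement–Jacquet (1972), §11 (Lemma 11.5–11.6: "la série thêta est à croissance lente").
[cite: GodementJacquetLNM260, §11] -/
theorem exists_tsum_enorm_vecMul_le_archHeight_rpow {Ψ : (Fin N → AdeleRing (𝓞 K) K) → ℂ} {k : ℕ} {M : ℝ}
    (hM0 : 0 ≤ M) (hM : ∀ x, ‖Ψ x‖ ≤ M * (1 + ‖vecInfinitePart K N x‖) ^ (-(k : ℝ)))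
    {Cf : Set (Fin N → FiniteAdeleRing (𝓞 K) K)} (hCfc : IsCompact Cf)
    (hCf : ∀ x, vecFinitePart K N x ∉ Cf → Ψ x = 0)
    {𝒴 : Set (GL (Fin N) (FiniteAdeleRing (𝓞 K) K))} (h𝒴 : IsCompact 𝒴)
    {θ : ℝ} (hθ : (N : ℝ) * Module.finrank ℚ K < θ) (hθk : θ ≤ k) :
    ∃ B : ℝ≥0∞, B ≠ ⊤ ∧ ∀ L : GL (Fin N) (AdeleRing (𝓞 K) K), GLn.sndHom N K L ∈ 𝒴 →
      ∑' v : Fin N → K, (‖Ψ (ratVec K v ᵥ* (L : Matrix (Fin N) (Fin N) (AdeleRing (𝓞 K) K)))‖ₑ : ℝ≥0∞) ≤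
        B * ENNReal.ofReal ((max 1 ((N : ℝ) ^ 2 * (GLn.archHeight N K L : ℝ))) ^ θ) := by
  have hθ0 : 0 ≤ θ := le_trans (by positivity) hθ.le
  obtain ⟨C', hC'c, hC'⟩ := exists_isCompact_vecFinitePart_mem K hCfc h𝒴
  -- the lattice sum at `L = 1`
  set Z : ℝ≥0∞ := ∑' v : ↥{v : Fin N → K | v ≠ 0 ∧ vecFinitePart K N (ratVec K v) ∈ C'},
    ENNReal.ofReal (‖vecInfinitePart K N (ratVec K (v : Fin N → K))‖ ^ (-θ)) with hZ
  have hZtop : Z < ⊤ := by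
    have h := tsum_norm_vecInfinitePart_rpow_neg_lt_top K (n := N) (1 : GL (Fin N) (AdeleRing (𝓞 K) K)) hC'c hθ
    simp only [Matrix.GeneralLinearGroup.coe_one, Matrix.vecMul_one] at h
    have hS : {v : Fin N → K | v ≠ 0 ∧ vecFinitePart K N (ratVec K v ᵥ*
        ((1 : GL (Fin N) (AdeleRing (𝓞 K) K)) : Matrix (Fin N) (Fin N) (AdeleRing (𝓞 K) K))) ∈ C'} =
        {v : Fin N → K | v ≠ 0 ∧ vecFinitePart K N (ratVec K v) ∈ C'} := by
      ext v
      simp only [Matrix.GeneralLinearGroup.coe_one, Matrix.vecMul_one, mem_setOf_eq]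
    rw [hZ, ← tsum_congr_set_coe (fun v : Fin N → K =>
      ENNReal.ofReal (‖vecInfinitePart K N (ratVec K v)‖ ^ (-θ))) hS]
    exact h
  refine ⟨ENNReal.ofReal M + ENNReal.ofReal M * Z, ?_, fun L hL => ?_⟩
  · exact ENNReal.add_ne_top.2 ⟨ENNReal.ofReal_ne_top, ENNReal.mul_ne_top ENNReal.ofReal_ne_top hZtop.ne⟩
  set G : ℝ := max 1 ((N : ℝ) ^ 2 * (GLn.archHeight N K L : ℝ)) with hG
  have hG1 : 1 ≤ G := le_max_left _ _
  have hG0 : 0 < G := one_pos.trans_le hG1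
  have hGL := (sum_norm_inv_arch_le_mul_archHeight K L).trans (le_max_right 1 _)
  have hmain := tsum_enorm_vecMul_le_of_decay K hM0 hM hCf L (hC' L hL) hG0 hGL hθ0 hθk
  refine hmain.trans ?_
  have hGθ : G⁻¹ ^ (-θ) = G ^ θ := by
    rw [Real.inv_rpow hG0.le, ← Real.rpow_neg hG0.le, neg_neg]
  have hGθ1 : 1 ≤ G ^ θ := Real.one_le_rpow hG1 hθ0
  rw [hGθ, ENNReal.ofReal_mul hM0, add_mul]
  refine add_le_add ?_ ?_
  · calc ENNReal.ofReal M = ENNReal.ofReal M * 1 := (mul_one _).symm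
      _ ≤ ENNReal.ofReal M * ENNReal.ofReal (G ^ θ) :=
          mul_le_mul_right (by rwa [← ENNReal.ofReal_one, ENNReal.ofReal_le_ofReal_iff (zero_le_one.trans hGθ1)]) _
  · rw [mul_assoc, mul_comm (ENNReal.ofReal (G ^ θ)) Z, ← mul_assoc]

end Literature.NumberTheory.Automorphic
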